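import Literature.NumberTheory.LFunctions.WeightedDiscreteMeanValue
import Mathlib.Analysis.SpecialFunctions.SmoothTransition
import HarnessLib

/-!
# Admissible weights for the weighted discrete mean values: smooth windows
# (Conrey–Iwaniec 2002, §5, the "function `f` of `𝒞¹` class" of Lemma 5.1, and §8)

B. Conrey, H. Iwaniec, *Spacing of zeros of Hecke L-functions and the class number problem*,
Acta Arith. 103 (2002), §5 Lemma 5.1 (5.3) and §8 [held text `paper:arxiv-math_0111012`, p0013,
p0018–p0019].

The weighted discrete mean values (`WeightedDiscreteMeanValue.lean`, Lemma 5.3 / Proposition 5.4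
with point-dependent weights) ask of each weight `ω` that it be `C¹` on `ℝ` with `ω, ω′ ∈ L¹ ∩ L²`
and control `‖ω‖₂² + ‖ω′‖₂²` (the paper's `c_f = ∫_1^∞ (|f|²/x + x|f′|²) dx` for `ω(y) = f(e^y)`).
In §8 the weights are restrictions of smooth functions `Ω` (built from `V_s`, `v_s`, `w_s`) to a
range of `n`; this file packages the bookkeeping once and for all:

* `exists_smoothWindow`: for `α ≤ β` a `C¹` function `Θ : ℝ → [0,1]`, `= 1` on `[α, β]`, `= 0` off
  `[α−1, β+1]`, `|Θ′| ≤ C₀` with ONE absolute `C₀` (from Mathlib's `Real.smoothTransition`);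
  `exists_smoothHalfWindow`: the same with `β = +∞`;
* `window_weight_admissible`: if `Ω : ℝ → ℂ` is differentiable with `‖Ω‖, ‖Ω′‖ ≤ M` on
  `[α−1, β+1]`, then `ω = Θ·Ω` is admissible with `‖ω‖₂² + ‖ω′‖₂² ≤ (1 + (C₀+1)²) M² (β − α + 2)`
  — the shape "`c ≪` (sup of the weight and its dilation-derivative)² × (logarithmic length of the
  range)" used for `A_{11}, A_{12}, A_{21}, …` in §8;
* `halfWindow_weight_admissible`: the half-line version with an `L¹ ∩ L²` majorant `Φ` of
  `‖Ω‖, ‖Ω′‖` on `[α−1, ∞)`: `‖ω‖₂² + ‖ω′‖₂² ≤ (1 + (C₀+1)²) ∫_{α−1}^∞ Φ²` (for `A_{13}, A_{23},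
  A_{33}`).

Everything PROVED; no definition (windows are produced existentially).

«The programme SEARCHES and TYPES; no claim about Landau–Siegel zeros until a kernel theorem says so.»

## References
* [ConreyIwaniec2002] B. Conrey, H. Iwaniec, Acta Arith. 103 (2002) 259–312, arXiv:math/0111012:
  §5 Lemma 5.1 (5.3), Lemma 5.3 (5.17); §8 ("partition this sum smoothly", p. 18).
-/

noncomputable section

open Complex MeasureTheory Filter Set Real
open scoped Topology

namespace Literature.NumberTheory.LFunctions

namespace WeightedMeanValue

/-! ## §1. Smooth windows from `Real.smoothTransition` -/

/-- The derivative of `Real.smoothTransition` is bounded on `ℝ` (it is continuous and vanishes off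
`[0, 1]`). [cite: ConreyIwaniec2002, Lemma 5.1 (5.3)] -/
theorem exists_abs_deriv_smoothTransition_le :
    ∃ C : ℝ, 0 < C ∧ ∀ x : ℝ, |deriv Real.smoothTransition x| ≤ C := by
  have hC1 : ContDiff ℝ 1 Real.smoothTransition := Real.smoothTransition.contDiff
  have hcont : Continuous (deriv Real.smoothTransition) := hC1.continuous_deriv le_rfl
  obtain ⟨C, hC⟩ := isCompact_Icc.exists_bound_of_continuousOn (s := Set.Icc (0 : ℝ) 1)
    hcont.continuousOn
  refine ⟨max C 1, by positivity, fun x => ?_⟩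
  by_cases hx : x ∈ Set.Icc (0 : ℝ) 1
  · exact (hC x hx).trans (le_max_left _ _)
  · -- off `[0,1]` the function is locally constant
    have hderiv : deriv Real.smoothTransition x = 0 := by
      rw [Set.mem_Icc, not_and_or, not_le, not_le] at hx
      rcases hx with hx | hx
      · have hev : Real.smoothTransition =ᶠ[𝓝 x] fun _ => (0 : ℝ) := by
          filter_upwards [Iio_mem_nhds hx] with y hy
          exact Real.smoothTransition.zero_of_nonpos hy.le
        rw [hev.deriv_eq, deriv_const]
      · have hev : Real.smoothTransition =ᶠ[𝓝 x] fun _ => (1 : ℝ) := by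
          filter_upwards [Ioi_mem_nhds hx] with y hy
          exact Real.smoothTransition.one_of_one_le hy.le
        rw [hev.deriv_eq, deriv_const]
    rw [hderiv, abs_zero]; positivity

/-- **Smooth windows.** There is an absolute `C₀ > 0` such that for all `α ≤ β` there is a
differentiable `Θ : ℝ → [0, 1]` with `Θ = 1` on `[α, β]`, `Θ = 0` off `[α − 1, β + 1]`,
`|Θ′| ≤ C₀` everywhere and `Θ′ = 0` off `[α − 1, β + 1]` (a smooth partition piece, §8 p. 18:
"we partition this sum smoothly"). [cite: ConreyIwaniec2002, §8 (8.5)] -/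
theorem exists_smoothWindow :
    ∃ C₀ : ℝ, 0 < C₀ ∧ ∀ α β : ℝ, α ≤ β → ∃ Θ : ℝ → ℝ,
      Differentiable ℝ Θ ∧ (∀ y, y ∈ Set.Icc α β → Θ y = 1) ∧
      (∀ y, y ∉ Set.Icc (α - 1) (β + 1) → Θ y = 0) ∧ (∀ y, 0 ≤ Θ y ∧ Θ y ≤ 1) ∧
      (∀ y, |deriv Θ y| ≤ C₀) ∧ (∀ y, y ∉ Set.Icc (α - 1) (β + 1) → deriv Θ y = 0) := by
  obtain ⟨C, hC, hder⟩ := exists_abs_deriv_smoothTransition_le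
  refine ⟨2 * C, by positivity, fun α β hαβ => ?_⟩
  set f : ℝ → ℝ := fun y => Real.smoothTransition (y - α + 1) with hf
  set g : ℝ → ℝ := fun y => Real.smoothTransition (β + 1 - y) with hg
  have hfd : Differentiable ℝ f :=
    (Real.smoothTransition.contDiff (n := 1)).differentiable (by norm_num) |>.comp (by fun_prop)
  have hgd : Differentiable ℝ g :=
    (Real.smoothTransition.contDiff (n := 1)).differentiable (by norm_num) |>.comp (by fun_prop)
  have hsd : Differentiable ℝ Real.smoothTransition :=
    (Real.smoothTransition.contDiff (n := 1)).differentiable (by norm_num)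
  -- derivatives of the two factors
  have hf' : ∀ y, deriv f y = deriv Real.smoothTransition (y - α + 1) := by
    intro y
    have h1 : HasDerivAt (fun y : ℝ => y - α + 1) 1 y := by
      simpa using ((hasDerivAt_id y).sub_const α).add_const (1 : ℝ)
    have h := (hsd (y - α + 1)).hasDerivAt.comp y h1
    rw [mul_one] at h
    exact h.deriv
  have hg' : ∀ y, deriv g y = -deriv Real.smoothTransition (β + 1 - y) := by
    intro y
    have h1 : HasDerivAt (fun y : ℝ => β + 1 - y) (-1) y := by
      simpa using (hasDerivAt_id y).const_sub (β + 1)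
    have h := (hsd (β + 1 - y)).hasDerivAt.comp y h1
    rw [mul_neg_one] at h
    exact h.deriv
  refine ⟨fun y => f y * g y, hfd.mul hgd, ?_, ?_, ?_, ?_, ?_⟩
  · intro y hy
    simp only [hf, hg]
    rw [Real.smoothTransition.one_of_one_le (by linarith [hy.1]),
      Real.smoothTransition.one_of_one_le (by linarith [hy.2]), one_mul]
  · intro y hy
    rw [Set.mem_Icc, not_and_or, not_le, not_le] at hy
    simp only [hf, hg]
    rcases hy with hy | hy
    · rw [Real.smoothTransition.zero_of_nonpos (by linarith), zero_mul]
    · rw [Real.smoothTransition.zero_of_nonpos (x := β + 1 - y) (by linarith), mul_zero]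
  · intro y
    exact ⟨mul_nonneg (Real.smoothTransition.nonneg _) (Real.smoothTransition.nonneg _),
      mul_le_one₀ (Real.smoothTransition.le_one _) (Real.smoothTransition.nonneg _)
        (Real.smoothTransition.le_one _)⟩
  · intro y
    rw [deriv_fun_mul (hfd y) (hgd y), hf', hg']
    have h1 := hder (y - α + 1)
    have h2 := hder (β + 1 - y)
    have hf0 : |f y| ≤ 1 := by
      rw [abs_of_nonneg (Real.smoothTransition.nonneg _)]; exact Real.smoothTransition.le_one _
    have hg0 : |g y| ≤ 1 := by
      rw [abs_of_nonneg (Real.smoothTransition.nonneg _)]; exact Real.smoothTransition.le_one _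
    calc |deriv Real.smoothTransition (y - α + 1) * g y + f y * -deriv Real.smoothTransition (β + 1 - y)|
        ≤ |deriv Real.smoothTransition (y - α + 1) * g y| + |f y * -deriv Real.smoothTransition (β + 1 - y)| :=
          abs_add_le _ _
      _ = |deriv Real.smoothTransition (y - α + 1)| * |g y| + |f y| * |deriv Real.smoothTransition (β + 1 - y)| := by
          rw [abs_mul, abs_mul, abs_neg]
      _ ≤ C * 1 + 1 * C := by gcongr
      _ = 2 * C := by ring
  · intro y hy
    rw [Set.mem_Icc, not_and_or, not_le, not_le] at hy
    rcases hy with hy | hy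
    · have hev : (fun y => f y * g y) =ᶠ[𝓝 y] fun _ => (0 : ℝ) := by
        filter_upwards [Iio_mem_nhds hy] with z hz
        have hz' := Set.mem_Iio.mp hz
        simp only [hf]
        rw [Real.smoothTransition.zero_of_nonpos (by linarith), zero_mul]
      rw [hev.deriv_eq, deriv_const]
    · have hev : (fun y => f y * g y) =ᶠ[𝓝 y] fun _ => (0 : ℝ) := by
        filter_upwards [Ioi_mem_nhds hy] with z hz
        have hz' := Set.mem_Ioi.mp hz
        simp only [hg]
        rw [Real.smoothTransition.zero_of_nonpos (x := β + 1 - z) (by linarith), mul_zero]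
      rw [hev.deriv_eq, deriv_const]

/-- **Smooth half-windows.** There is an absolute `C₀ > 0` such that for every `α` there is a
differentiable `Θ : ℝ → [0, 1]` with `Θ = 1` on `[α, ∞)`, `Θ = 0` on `(−∞, α − 1]`, `|Θ′| ≤ C₀`
everywhere and `Θ′ = 0` off `[α − 1, α]`. [cite: ConreyIwaniec2002, §8 (8.5)] -/
theorem exists_smoothHalfWindow :
    ∃ C₀ : ℝ, 0 < C₀ ∧ ∀ α : ℝ, ∃ Θ : ℝ → ℝ,
      Differentiable ℝ Θ ∧ (∀ y, α ≤ y → Θ y = 1) ∧ (∀ y, y ≤ α - 1 → Θ y = 0) ∧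
      (∀ y, 0 ≤ Θ y ∧ Θ y ≤ 1) ∧ (∀ y, |deriv Θ y| ≤ C₀) ∧
      (∀ y, y ∉ Set.Icc (α - 1) α → deriv Θ y = 0) := by
  obtain ⟨C, hC, hder⟩ := exists_abs_deriv_smoothTransition_le
  refine ⟨C, hC, fun α => ?_⟩
  set f : ℝ → ℝ := fun y => Real.smoothTransition (y - α + 1) with hf
  have hsd : Differentiable ℝ Real.smoothTransition :=
    (Real.smoothTransition.contDiff (n := 1)).differentiable (by norm_num)
  have hfd : Differentiable ℝ f := hsd.comp (by fun_prop)
  have hf' : ∀ y, deriv f y = deriv Real.smoothTransition (y - α + 1) := by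
    intro y
    have h1 : HasDerivAt (fun y : ℝ => y - α + 1) 1 y := by
      simpa using ((hasDerivAt_id y).sub_const α).add_const (1 : ℝ)
    have h := (hsd (y - α + 1)).hasDerivAt.comp y h1
    rw [mul_one] at h
    exact h.deriv
  refine ⟨f, hfd, ?_, ?_, ?_, ?_, ?_⟩
  · intro y hy; simp only [hf]; exact Real.smoothTransition.one_of_one_le (by linarith)
  · intro y hy; simp only [hf]; exact Real.smoothTransition.zero_of_nonpos (by linarith)
  · intro y; exact ⟨Real.smoothTransition.nonneg _, Real.smoothTransition.le_one _⟩
  · intro y; rw [hf']; exact hder _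
  · intro y hy
    rw [Set.mem_Icc, not_and_or, not_le, not_le] at hy
    rcases hy with hy | hy
    · have hev : f =ᶠ[𝓝 y] fun _ => (0 : ℝ) := by
        filter_upwards [Iio_mem_nhds hy] with z hz
        have hz' := Set.mem_Iio.mp hz
        simp only [hf]; exact Real.smoothTransition.zero_of_nonpos (by linarith)
      rw [hev.deriv_eq, deriv_const]
    · have hev : f =ᶠ[𝓝 y] fun _ => (1 : ℝ) := by
        filter_upwards [Ioi_mem_nhds hy] with z hz
        have hz' := Set.mem_Ioi.mp hz
        simp only [hf]; exact Real.smoothTransition.one_of_one_le (by linarith)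
      rw [hev.deriv_eq, deriv_const]

/-! ## §2. Windowed weights are admissible -/

/-- A measurable function dominated by an `L¹ ∩ L²`-type bound on a set and vanishing off it:
the basic integrability bookkeeping. If `‖h y‖ ≤ B · 𝟙_E(y) Φ(y)`-style bounds hold with `Φ`
integrable on `E`, then `h` is integrable. (Helper.) [cite: ConreyIwaniec2002, Lemma 5.1 (5.3)] -/
theorem integrable_of_norm_le_indicator {h : ℝ → ℂ} {Φ : ℝ → ℝ} {E : Set ℝ}
    (hE : MeasurableSet E) (hm : AEStronglyMeasurable h volume)
    (hΦ : IntegrableOn Φ E) (hle : ∀ y, ‖h y‖ ≤ Set.indicator E Φ y) : Integrable h := by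
  refine Integrable.mono' ?_ hm (Eventually.of_forall hle)
  exact (integrable_indicator_iff hE).mpr hΦ

/-- **Windowed weights are admissible (compact window).** Let `Θ` be a window for `[α, β]` as in
`exists_smoothWindow` (with derivative bound `C₀`) and `Ω : ℝ → ℂ` differentiable with
`‖Ω(y)‖ ≤ M` and `‖Ω′(y)‖ ≤ M` for `y ∈ [α−1, β+1]`. Then `ω = Θ·Ω` is `C¹`-admissible for the
weighted mean values: `ω` differentiable, `ω, ω′ ∈ L¹ ∩ L²`, and
`‖ω‖₂² + ‖ω′‖₂² ≤ (1 + (C₀ + 1)²) M² (β − α + 2)`; moreover `ω = Ω` on `[α, β]`.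
(This is `c_f ≪ (sup|f| + sup|x f′|)² · log(range)` for the §8 weights.)
[cite: ConreyIwaniec2002, Lemma 5.3 (5.17), §8] -/
theorem window_weight_admissible {α β C₀ M : ℝ} (hαβ : α ≤ β) {Θ : ℝ → ℝ}
    (hΘd : Differentiable ℝ Θ) (hΘ0 : ∀ y, y ∉ Set.Icc (α - 1) (β + 1) → Θ y = 0)
    (hΘ01 : ∀ y, 0 ≤ Θ y ∧ Θ y ≤ 1) (hΘ' : ∀ y, |deriv Θ y| ≤ C₀)
    (hΘ'0 : ∀ y, y ∉ Set.Icc (α - 1) (β + 1) → deriv Θ y = 0)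
    {Ω : ℝ → ℂ} (hΩd : Differentiable ℝ Ω)
    (hΩ : ∀ y ∈ Set.Icc (α - 1) (β + 1), ‖Ω y‖ ≤ M)
    (hΩ' : ∀ y ∈ Set.Icc (α - 1) (β + 1), ‖deriv Ω y‖ ≤ M) :
    Differentiable ℝ (fun y => (Θ y : ℂ) * Ω y) ∧
    Integrable (fun y => (Θ y : ℂ) * Ω y) ∧
    Integrable (deriv (fun y => (Θ y : ℂ) * Ω y)) ∧
    MemLp (fun y => (Θ y : ℂ) * Ω y) 2 ∧
    MemLp (deriv (fun y => (Θ y : ℂ) * Ω y)) 2 ∧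
    (∫ y : ℝ, ‖(Θ y : ℂ) * Ω y‖ ^ 2) + (∫ y : ℝ, ‖deriv (fun y => (Θ y : ℂ) * Ω y) y‖ ^ 2) ≤
      (1 + (C₀ + 1) ^ 2) * M ^ 2 * (β - α + 2) := by
  set ω : ℝ → ℂ := fun y => (Θ y : ℂ) * Ω y with hω
  set E : Set ℝ := Set.Icc (α - 1) (β + 1) with hE
  have hEm : MeasurableSet E := measurableSet_Icc
  have hEvol : volume E = ENNReal.ofReal (β - α + 2) := by
    rw [hE, Real.volume_Icc]; congr 1; ring
  have hlen : 0 ≤ β - α + 2 := by linarith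
  have hC₀ : 0 ≤ C₀ := le_trans (abs_nonneg _) (hΘ' 0)
  -- differentiability
  have hΘdC : Differentiable ℝ (fun y => (Θ y : ℂ)) := by
    intro y; exact (hΘd y).hasDerivAt.ofReal_comp.differentiableAt
  have hωd : Differentiable ℝ ω := hΘdC.mul hΩd
  -- the derivative and its bound
  have hderiv : ∀ y, deriv ω y = ((deriv Θ y : ℝ) : ℂ) * Ω y + (Θ y : ℂ) * deriv Ω y := by
    intro y
    have h1 : HasDerivAt (fun y => (Θ y : ℂ)) ((deriv Θ y : ℝ) : ℂ) y :=
      (hΘd y).hasDerivAt.ofReal_comp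
    have h2 : HasDerivAt Ω (deriv Ω y) y := (hΩd y).hasDerivAt
    exact (h1.mul h2).deriv
  have hω_bound : ∀ y, ‖ω y‖ ≤ Set.indicator E (fun _ => M) y := by
    intro y
    by_cases hy : y ∈ E
    · rw [Set.indicator_of_mem hy]
      simp only [hω, norm_mul, Complex.norm_real, Real.norm_eq_abs]
      rw [abs_of_nonneg (hΘ01 y).1]
      calc Θ y * ‖Ω y‖ ≤ 1 * M := by
            gcongr
            · exact (hΘ01 y).2
            · exact hΩ y hy
        _ = M := one_mul M
    · rw [Set.indicator_of_notMem hy]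
      simp only [hω, norm_mul, Complex.norm_real, Real.norm_eq_abs, hΘ0 y hy, abs_zero, zero_mul]
      exact le_rfl
  have hω'_bound : ∀ y, ‖deriv ω y‖ ≤ Set.indicator E (fun _ => (C₀ + 1) * M) y := by
    intro y
    rw [hderiv]
    by_cases hy : y ∈ E
    · rw [Set.indicator_of_mem hy]
      calc ‖((deriv Θ y : ℝ) : ℂ) * Ω y + (Θ y : ℂ) * deriv Ω y‖
          ≤ ‖((deriv Θ y : ℝ) : ℂ) * Ω y‖ + ‖(Θ y : ℂ) * deriv Ω y‖ := norm_add_le _ _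
        _ = |deriv Θ y| * ‖Ω y‖ + |Θ y| * ‖deriv Ω y‖ := by
            rw [norm_mul, norm_mul, Complex.norm_real, Complex.norm_real, Real.norm_eq_abs,
              Real.norm_eq_abs]
        _ ≤ C₀ * M + 1 * M := by
            gcongr
            · exact hΘ' y
            · exact hΩ y hy
            · rw [abs_of_nonneg (hΘ01 y).1]; exact (hΘ01 y).2
            · exact hΩ' y hy
        _ = (C₀ + 1) * M := by ring
    · rw [Set.indicator_of_notMem hy, hΘ0 y hy, hΘ'0 y hy]
      simp
  -- measurability
  have hωm : AEStronglyMeasurable ω volume := hωd.continuous.aestronglyMeasurable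
  have hω'm : AEStronglyMeasurable (deriv ω) volume :=
    (measurable_deriv ω).aestronglyMeasurable
  -- integrability (L¹)
  have hconstE : ∀ c : ℝ, IntegrableOn (fun _ : ℝ => c) E volume := fun c => by
    rw [hE]; exact integrableOn_const (by rw [Real.volume_Icc]; exact ENNReal.ofReal_ne_top)
  have hωi : Integrable ω := integrable_of_norm_le_indicator hEm hωm (hconstE M) hω_bound
  have hω'i : Integrable (deriv ω) :=
    integrable_of_norm_le_indicator hEm hω'm (hconstE _) hω'_bound
  -- L² via the squared bounds
  have hsq_bound : ∀ y, ‖ω y‖ ^ 2 ≤ Set.indicator E (fun _ => M ^ 2) y := by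
    intro y
    have h := hω_bound y
    by_cases hy : y ∈ E
    · rw [Set.indicator_of_mem hy] at h ⊢; exact pow_le_pow_left₀ (norm_nonneg _) h 2
    · rw [Set.indicator_of_notMem hy] at h ⊢
      have : ‖ω y‖ = 0 := le_antisymm h (norm_nonneg _)
      rw [this]; norm_num
  have hsq'_bound : ∀ y, ‖deriv ω y‖ ^ 2 ≤ Set.indicator E (fun _ => ((C₀ + 1) * M) ^ 2) y := by
    intro y
    have h := hω'_bound y
    by_cases hy : y ∈ E
    · rw [Set.indicator_of_mem hy] at h ⊢; exact pow_le_pow_left₀ (norm_nonneg _) h 2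
    · rw [Set.indicator_of_notMem hy] at h ⊢
      have : ‖deriv ω y‖ = 0 := le_antisymm h (norm_nonneg _)
      rw [this]; norm_num
  have hsq_int : Integrable (fun y => ‖ω y‖ ^ 2) := by
    refine Integrable.mono' ((integrable_indicator_iff hEm).mpr (hconstE (M ^ 2)))
      (hωm.norm.pow 2) (Eventually.of_forall fun y => ?_)
    rw [Real.norm_of_nonneg (by positivity)]; exact hsq_bound y
  have hsq'_int : Integrable (fun y => ‖deriv ω y‖ ^ 2) := by
    refine Integrable.mono' ((integrable_indicator_iff hEm).mpr (hconstE (((C₀ + 1) * M) ^ 2)))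
      (hω'm.norm.pow 2) (Eventually.of_forall fun y => ?_)
    rw [Real.norm_of_nonneg (by positivity)]; exact hsq'_bound y
  have hω2 : MemLp ω 2 := (memLp_two_iff_integrable_sq_norm hωm).mpr hsq_int
  have hω'2 : MemLp (deriv ω) 2 := (memLp_two_iff_integrable_sq_norm hω'm).mpr hsq'_int
  -- the norm bound
  have hI1 : ∫ y : ℝ, ‖ω y‖ ^ 2 ≤ M ^ 2 * (β - α + 2) := by
    calc ∫ y : ℝ, ‖ω y‖ ^ 2 ≤ ∫ y : ℝ, Set.indicator E (fun _ => M ^ 2) y :=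
          integral_mono hsq_int ((integrable_indicator_iff hEm).mpr (hconstE _)) hsq_bound
      _ = M ^ 2 * (β - α + 2) := by
          rw [integral_indicator hEm, setIntegral_const, Measure.real, hEvol,
            ENNReal.toReal_ofReal hlen, smul_eq_mul, mul_comm]
  have hI2 : ∫ y : ℝ, ‖deriv ω y‖ ^ 2 ≤ ((C₀ + 1) * M) ^ 2 * (β - α + 2) := by
    calc ∫ y : ℝ, ‖deriv ω y‖ ^ 2 ≤ ∫ y : ℝ, Set.indicator E (fun _ => ((C₀ + 1) * M) ^ 2) y :=
          integral_mono hsq'_int ((integrable_indicator_iff hEm).mpr (hconstE _)) hsq'_bound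
      _ = ((C₀ + 1) * M) ^ 2 * (β - α + 2) := by
          rw [integral_indicator hEm, setIntegral_const, Measure.real, hEvol,
            ENNReal.toReal_ofReal hlen, smul_eq_mul, mul_comm]
  refine ⟨hωd, hωi, hω'i, hω2, hω'2, ?_⟩
  calc (∫ y : ℝ, ‖ω y‖ ^ 2) + (∫ y : ℝ, ‖deriv ω y‖ ^ 2)
      ≤ M ^ 2 * (β - α + 2) + ((C₀ + 1) * M) ^ 2 * (β - α + 2) := add_le_add hI1 hI2
    _ = (1 + (C₀ + 1) ^ 2) * M ^ 2 * (β - α + 2) := by ring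

/-- **Windowed weights are admissible (half-line window).** Let `Θ` be a half-window for `[α, ∞)`
as in `exists_smoothHalfWindow` and `Ω : ℝ → ℂ` differentiable with an `L¹ ∩ L²` majorant on
`[α − 1, ∞)`: `‖Ω(y)‖ ≤ Φ(y)`, `‖Ω′(y)‖ ≤ Φ(y)` for `y ≥ α − 1`, `Φ` and `Φ²` integrable on `[α − 1, ∞)`. Then `ω = Θ·Ω` is admissible with
`‖ω‖₂² + ‖ω′‖₂² ≤ (1 + (C₀ + 1)²) ∫_{α−1}^∞ Φ²`, and `ω = Ω` on `[α, ∞)` (the §8 weights of the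
range `n ≫ T`). [cite: ConreyIwaniec2002, Lemma 5.3 (5.17), §8] -/
theorem halfWindow_weight_admissible {α C₀ : ℝ} {Θ : ℝ → ℝ}
    (hΘd : Differentiable ℝ Θ) (hΘ0 : ∀ y, y ≤ α - 1 → Θ y = 0)
    (hΘ01 : ∀ y, 0 ≤ Θ y ∧ Θ y ≤ 1) (hΘ' : ∀ y, |deriv Θ y| ≤ C₀)
    (hΘ'0 : ∀ y, y ∉ Set.Icc (α - 1) α → deriv Θ y = 0)
    {Ω : ℝ → ℂ} (hΩd : Differentiable ℝ Ω) {Φ : ℝ → ℝ}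
    (hΦ1 : IntegrableOn Φ (Set.Ici (α - 1)))
    (hΦ2 : IntegrableOn (fun y => Φ y ^ 2) (Set.Ici (α - 1)))
    (hΩ : ∀ y, α - 1 ≤ y → ‖Ω y‖ ≤ Φ y) (hΩ' : ∀ y, α - 1 ≤ y → ‖deriv Ω y‖ ≤ Φ y) :
    Differentiable ℝ (fun y => (Θ y : ℂ) * Ω y) ∧
    Integrable (fun y => (Θ y : ℂ) * Ω y) ∧
    Integrable (deriv (fun y => (Θ y : ℂ) * Ω y)) ∧
    MemLp (fun y => (Θ y : ℂ) * Ω y) 2 ∧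
    MemLp (deriv (fun y => (Θ y : ℂ) * Ω y)) 2 ∧
    (∫ y : ℝ, ‖(Θ y : ℂ) * Ω y‖ ^ 2) + (∫ y : ℝ, ‖deriv (fun y => (Θ y : ℂ) * Ω y) y‖ ^ 2) ≤
      (1 + (C₀ + 1) ^ 2) * ∫ y in Set.Ici (α - 1), Φ y ^ 2 := by
  set ω : ℝ → ℂ := fun y => (Θ y : ℂ) * Ω y with hω
  set E : Set ℝ := Set.Ici (α - 1) with hE
  have hEm : MeasurableSet E := measurableSet_Ici
  have hC₀ : 0 ≤ C₀ := le_trans (abs_nonneg _) (hΘ' 0)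
  have hΘdC : Differentiable ℝ (fun y => (Θ y : ℂ)) := by
    intro y; exact (hΘd y).hasDerivAt.ofReal_comp.differentiableAt
  have hωd : Differentiable ℝ ω := hΘdC.mul hΩd
  have hderiv : ∀ y, deriv ω y = ((deriv Θ y : ℝ) : ℂ) * Ω y + (Θ y : ℂ) * deriv Ω y := by
    intro y
    have h1 : HasDerivAt (fun y => (Θ y : ℂ)) ((deriv Θ y : ℝ) : ℂ) y :=
      (hΘd y).hasDerivAt.ofReal_comp
    exact (h1.mul (hΩd y).hasDerivAt).deriv
  have hΘ0' : ∀ y, y ∉ E → Θ y = 0 := fun y hy => hΘ0 y (by rw [hE, Set.mem_Ici, not_le] at hy; exact hy.le)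
  have hΘ'0' : ∀ y, y ∉ E → deriv Θ y = 0 := fun y hy => by
    refine hΘ'0 y fun h => hy ?_
    exact h.1
  -- bounds by the majorant
  have hω_bound : ∀ y, ‖ω y‖ ≤ Set.indicator E Φ y := by
    intro y
    by_cases hy : y ∈ E
    · rw [Set.indicator_of_mem hy]
      simp only [hω, norm_mul, Complex.norm_real, Real.norm_eq_abs]
      rw [abs_of_nonneg (hΘ01 y).1]
      calc Θ y * ‖Ω y‖ ≤ 1 * Φ y :=
            mul_le_mul (hΘ01 y).2 (hΩ y hy) (norm_nonneg _) zero_le_one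
        _ = Φ y := one_mul _
    · rw [Set.indicator_of_notMem hy]
      simp only [hω, norm_mul, Complex.norm_real, Real.norm_eq_abs, hΘ0' y hy, abs_zero, zero_mul]
      exact le_rfl
  have hω'_bound : ∀ y, ‖deriv ω y‖ ≤ Set.indicator E (fun y => (C₀ + 1) * Φ y) y := by
    intro y
    rw [hderiv]
    by_cases hy : y ∈ E
    · rw [Set.indicator_of_mem hy]
      calc ‖((deriv Θ y : ℝ) : ℂ) * Ω y + (Θ y : ℂ) * deriv Ω y‖
          ≤ ‖((deriv Θ y : ℝ) : ℂ) * Ω y‖ + ‖(Θ y : ℂ) * deriv Ω y‖ := norm_add_le _ _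
        _ = |deriv Θ y| * ‖Ω y‖ + |Θ y| * ‖deriv Ω y‖ := by
            rw [norm_mul, norm_mul, Complex.norm_real, Complex.norm_real, Real.norm_eq_abs,
              Real.norm_eq_abs]
        _ ≤ C₀ * Φ y + 1 * Φ y := by
            have hΘ1 : |Θ y| ≤ 1 := by rw [abs_of_nonneg (hΘ01 y).1]; exact (hΘ01 y).2
            exact add_le_add (mul_le_mul (hΘ' y) (hΩ y hy) (norm_nonneg _) hC₀)
              (mul_le_mul hΘ1 (hΩ' y hy) (norm_nonneg _) zero_le_one)
        _ = (C₀ + 1) * Φ y := by ring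
    · rw [Set.indicator_of_notMem hy, hΘ0' y hy, hΘ'0' y hy]
      simp
  have hωm : AEStronglyMeasurable ω volume := hωd.continuous.aestronglyMeasurable
  have hω'm : AEStronglyMeasurable (deriv ω) volume := (measurable_deriv ω).aestronglyMeasurable
  have hΦ1' : IntegrableOn (fun y => (C₀ + 1) * Φ y) E := hΦ1.const_mul _
  have hΦ2' : IntegrableOn (fun y => ((C₀ + 1) * Φ y) ^ 2) E := by
    have : (fun y => ((C₀ + 1) * Φ y) ^ 2) = fun y => (C₀ + 1) ^ 2 * Φ y ^ 2 := by
      funext y; ring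
    rw [this]; exact hΦ2.const_mul _
  have hωi : Integrable ω := integrable_of_norm_le_indicator hEm hωm hΦ1 hω_bound
  have hω'i : Integrable (deriv ω) := integrable_of_norm_le_indicator hEm hω'm hΦ1' hω'_bound
  have hsq_bound : ∀ y, ‖ω y‖ ^ 2 ≤ Set.indicator E (fun y => Φ y ^ 2) y := by
    intro y
    have h := hω_bound y
    by_cases hy : y ∈ E
    · rw [Set.indicator_of_mem hy] at h ⊢; exact pow_le_pow_left₀ (norm_nonneg _) h 2
    · rw [Set.indicator_of_notMem hy] at h ⊢
      have : ‖ω y‖ = 0 := le_antisymm h (norm_nonneg _)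
      rw [this]; norm_num
  have hsq'_bound : ∀ y, ‖deriv ω y‖ ^ 2 ≤ Set.indicator E (fun y => ((C₀ + 1) * Φ y) ^ 2) y := by
    intro y
    have h := hω'_bound y
    by_cases hy : y ∈ E
    · rw [Set.indicator_of_mem hy] at h ⊢; exact pow_le_pow_left₀ (norm_nonneg _) h 2
    · rw [Set.indicator_of_notMem hy] at h ⊢
      have : ‖deriv ω y‖ = 0 := le_antisymm h (norm_nonneg _)
      rw [this]; norm_num
  have hsq_int : Integrable (fun y => ‖ω y‖ ^ 2) := by
    refine Integrable.mono' ((integrable_indicator_iff hEm).mpr hΦ2) (hωm.norm.pow 2)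
      (Eventually.of_forall fun y => ?_)
    rw [Real.norm_of_nonneg (by positivity)]; exact hsq_bound y
  have hsq'_int : Integrable (fun y => ‖deriv ω y‖ ^ 2) := by
    refine Integrable.mono' ((integrable_indicator_iff hEm).mpr hΦ2') (hω'm.norm.pow 2)
      (Eventually.of_forall fun y => ?_)
    rw [Real.norm_of_nonneg (by positivity)]; exact hsq'_bound y
  have hω2 : MemLp ω 2 := (memLp_two_iff_integrable_sq_norm hωm).mpr hsq_int
  have hω'2 : MemLp (deriv ω) 2 := (memLp_two_iff_integrable_sq_norm hω'm).mpr hsq'_int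
  have hI1 : ∫ y : ℝ, ‖ω y‖ ^ 2 ≤ ∫ y in E, Φ y ^ 2 := by
    calc ∫ y : ℝ, ‖ω y‖ ^ 2 ≤ ∫ y : ℝ, Set.indicator E (fun y => Φ y ^ 2) y :=
          integral_mono hsq_int ((integrable_indicator_iff hEm).mpr hΦ2) hsq_bound
      _ = ∫ y in E, Φ y ^ 2 := integral_indicator hEm
  have hI2 : ∫ y : ℝ, ‖deriv ω y‖ ^ 2 ≤ (C₀ + 1) ^ 2 * ∫ y in E, Φ y ^ 2 := by
    calc ∫ y : ℝ, ‖deriv ω y‖ ^ 2 ≤ ∫ y : ℝ, Set.indicator E (fun y => ((C₀ + 1) * Φ y) ^ 2) y :=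
          integral_mono hsq'_int ((integrable_indicator_iff hEm).mpr hΦ2') hsq'_bound
      _ = ∫ y in E, ((C₀ + 1) * Φ y) ^ 2 := integral_indicator hEm
      _ = (C₀ + 1) ^ 2 * ∫ y in E, Φ y ^ 2 := by
          rw [← integral_const_mul]
          refine setIntegral_congr_fun hEm fun y _ => ?_
          ring
  have hI0 : 0 ≤ ∫ y in E, Φ y ^ 2 := setIntegral_nonneg hEm fun y _ => sq_nonneg _
  refine ⟨hωd, hωi, hω'i, hω2, hω'2, ?_⟩
  calc (∫ y : ℝ, ‖ω y‖ ^ 2) + (∫ y : ℝ, ‖deriv ω y‖ ^ 2)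
      ≤ (∫ y in E, Φ y ^ 2) + (C₀ + 1) ^ 2 * ∫ y in E, Φ y ^ 2 := add_le_add hI1 hI2
    _ = (1 + (C₀ + 1) ^ 2) * ∫ y in E, Φ y ^ 2 := by ring

end WeightedMeanValue

end Literature.NumberTheory.LFunctions

end
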